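import Literature.NumberTheory.Sieve.Maynard2016Lemma7ProbIndep
import Literature.NumberTheory.Sieve.Maynard2016Lemma7MainSum

/-!
# Maynard (2016), Lemma 7 — the class bound with smooth pattern weights (translated cutoffs)

J. Maynard, *Large gaps between primes*, Ann. of Math. 183 (2016), §6, proof of Lemma 7, the
paragraph before (6.33) («we may restrict `q` to a residue class modulo a prime `p`; the main term
is then multiplied by `≪_k 1/p`»).  Continuation of `Maynard2016Lemma7ProbIndep`.

The class bound of `Maynard2016Lemma7ProbIndep` (`sum_filter_mod_XL_sq_le`) controls the class sum
`Σ_{u ≡ c (p)} X_Λ(u)²` by the full second moments of the pattern weights `Λ^{[S,T]}`; its proof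
only ever sees the `p`-FREE parts of these weights.  Here we record the freedom this gives:

* `sum_filter_mod_XL_sq_le_of_pfPart`, `sum_filter_mod_Xwt_sq_le_totient_mul_Qform_of_pfPart` —
  the same bounds with `Λ^{[S,T]}` replaced by ANY family of weights `W_{S,T}` whose `p`-free parts
  are the `p`-free pattern weights `Λ^{(S,T)}` on the restricted box;
* `lamG` — sieve weights (5.3) with cutoffs depending on the slot on the `e`-side too, their
  support (`SuppG`, `admWt_lamG_tr`) and translated data `trF`, `trG`;
* `lam_scaleAt_eq` — for `p ∤ d_ℓ e_ℓ`, `λ_{p^S d, p^T e} = (−1)^{|S|+|T|} λ̃_{d,e}` where `λ̃` is the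
  weight with the TRANSLATED cutoffs `F_{ℓ,j}(t + [ℓ ∈ S] log p/log x)`, `G(t + [ℓ ∈ T] log p/log y)`;
* `pfPart_smoothWt_eq_patWt` — hence the smooth weight `W_{S,T} = (−1)^{|S|+|T|} λ̃ · [rbox²]`
  (`smoothWt`) has `p`-free part equal to the `p`-free pattern weight `Λ^{(S,T)}` of
  `Λ = λ · [rbox²]` (`i ∉ S ∪ T`; for `i ∈ S ∪ T` the pattern weight vanishes, `patWt_eq_zero_of_mem`);
* `ofReal_Qform_smoothWt_eq` — the quadratic form `Q(W, W)` of such a weight is the combination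
  `s² Σ_{j,j'} c_j c_{j'} F̃_{i,j}(0) F̃_{i,j'}(0) G̃_i(0)² · coupledLcmSumW φ⁻¹ …` of weighted coupled
  `lcm`-sums with the translated cutoffs on the free slots — the input of the uniform engine bound
  `eventually_norm_logpow_mul_coupledLcmSumW7_sub_le_of_psiMaj_le`.

## References

* J. Maynard, *Large gaps between primes*, Ann. of Math. (2) 183 (2016), 915–933; arXiv:1408.5110,
  §6, proof of Lemma 7 (before (6.33)). [Maynard2016LargeGaps]
-/

noncomputable section

open Finset
open scoped BigOperators ArithmeticFunction.Moebius

namespace Literature.NumberTheory.Sieve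

namespace Maynard2016

open LcmEuler

variable {k : ℕ}

/-! ### The class bound for arbitrary extensions of the `p`-free pattern weights -/

/-- `XL` only depends on the weight on `rbox²`. [cite: Maynard2016LargeGaps, Lemma 7 (proof, display (6.32))] -/
theorem XL_congr_rbox {X : ℕ} {i : Fin k} (Pd Ad Pe Ae : Fin k → ℤ)
    {W W' : (Fin k → ℕ) → (Fin k → ℕ) → ℝ}
    (h : ∀ d ∈ rbox k X i, ∀ e ∈ rbox k X i, W d e = W' d e) (u : ℕ) :
    XL k X i Pd Ad Pe Ae W u = XL k X i Pd Ad Pe Ae W' u := by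
  unfold XL
  refine Finset.sum_congr rfl fun d hd => Finset.sum_congr rfl fun e he => ?_
  rw [h d hd e he]

/-- **The class bound with arbitrary extensions**: as `sum_filter_mod_XL_sq_le`, with the full
pattern weights `Λ^{[S,T]}` replaced by any weights `W_{S,T}` whose `p`-free parts agree with the
`p`-free pattern weights `Λ^{(S,T)}` on `rbox²`:
`Σ_{u ∈ U_{pR'}, u ≡ c (p)} X_Λ(u)² ≤ (2·4^k/(p−1)) Σ_{S,T} Σ_{u ∈ U_{pR'}} X_{W_{S,T}}(u)²`.
[cite: Maynard2016LargeGaps, Lemma 7 (proof, before (6.33))] -/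
theorem sum_filter_mod_XL_sq_le_of_pfPart {p : ℕ} (hp : p.Prime) {X : ℕ} {i : Fin k}
    (Pd Ad Pe Ae : Fin k → ℤ) (hAd : ∀ j, j ≠ i → ¬ (p : ℤ) ∣ Ad j)
    (hAe : ∀ j, j ≠ i → ¬ (p : ℤ) ∣ Ae j) (hpk : 4 * (k - 1) ≤ p - 1)
    {R' : ℕ} (hR' : R' ≠ 0) (hpR' : Nat.Coprime p R')
    (hdiv : ∀ n, Squarefree n → n ≤ X → ¬ p ∣ n → n ∣ R') {c : ℕ} (hc : c ∈ unitsR p)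
    {Λ : (Fin k → ℕ) → (Fin k → ℕ) → ℝ}
    (hΛ : ∀ d e, Λ d e ≠ 0 → (∀ j, Squarefree (d j)) ∧ ∀ j, Squarefree (e j))
    (W : Finset (Fin k) → Finset (Fin k) → (Fin k → ℕ) → (Fin k → ℕ) → ℝ)
    (hW : ∀ S T, ∀ d ∈ rbox k X i, ∀ e ∈ rbox k X i,
      pfPart p (W S T) d e = patWt k X i p S T Λ d e) :
    ∑ u ∈ (unitsR (p * R')).filter (fun u => u % p = c), XL k X i Pd Ad Pe Ae Λ u ^ 2 ≤
      (2 * (4 : ℝ) ^ k / (p - 1 : ℝ)) *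
        ∑ S ∈ (Finset.univ : Finset (Fin k)).powerset, ∑ T ∈ (Finset.univ : Finset (Fin k)).powerset,
          ∑ u ∈ unitsR (p * R'), XL k X i Pd Ad Pe Ae (W S T) u ^ 2 := by
  classical
  have hp1 : (0 : ℝ) < (p : ℝ) - 1 := by
    have : (2 : ℝ) ≤ p := by exact_mod_cast hp.two_le
    linarith
  have hXW : ∀ (S T : Finset (Fin k)) (u : ℕ), XL k X i Pd Ad Pe Ae (pfPart p (W S T)) u =
      XL k X i Pd Ad Pe Ae (patWt k X i p S T Λ) u := fun S T u =>
    XL_congr_rbox Pd Ad Pe Ae (hW S T) u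
  -- periodicity of the `p`-free pattern variables
  have hper : ∀ (S T : Finset (Fin k)) (u : ℕ), XL k X i Pd Ad Pe Ae (patWt k X i p S T Λ) u =
      XL k X i Pd Ad Pe Ae (patWt k X i p S T Λ) (u % R') := fun S T u =>
    XL_congr_of_modEq Pd Ad Pe Ae (patWt_moduli_dvd S T hΛ hdiv) (Nat.mod_modEq u R').symm
  -- Step 1: Cauchy–Schwarz termwise, then exchange the sums
  have h1 : ∑ u ∈ (unitsR (p * R')).filter (fun u => u % p = c), XL k X i Pd Ad Pe Ae Λ u ^ 2 ≤
      (4 : ℝ) ^ k * ∑ S ∈ (Finset.univ : Finset (Fin k)).powerset,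
        ∑ T ∈ (Finset.univ : Finset (Fin k)).powerset,
          ∑ u ∈ (unitsR (p * R')).filter (fun u => u % p = c),
            XL k X i Pd Ad Pe Ae (patWt k X i p S T Λ) u ^ 2 := by
    refine (Finset.sum_le_sum fun u _ => XL_sq_le_sum_patWt_sq hp Pd Ad Pe Ae hΛ u).trans
      (le_of_eq ?_)
    rw [← Finset.mul_sum]
    congr 1
    exact Finset.sum_comm.trans (Finset.sum_congr rfl fun S _ => Finset.sum_comm)
  -- Step 2: CRT + averaging over the good classes, for the extension `W S T`
  have h2 : ∀ S T : Finset (Fin k),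
      ∑ u ∈ (unitsR (p * R')).filter (fun u => u % p = c),
          XL k X i Pd Ad Pe Ae (patWt k X i p S T Λ) u ^ 2 ≤
        (2 / ((p : ℝ) - 1)) * ∑ u ∈ unitsR (p * R'), XL k X i Pd Ad Pe Ae (W S T) u ^ 2 := by
    intro S T
    rw [sum_unitsR_filter_mod_eq_sum hp.ne_zero hR' hpR' hc
      (fun u => XL k X i Pd Ad Pe Ae (patWt k X i p S T Λ) u ^ 2) (fun u => by rw [← hper S T u])]
    have h3 := sum_unitsR_XL_pfPart_sq_le hp Pd Ad Pe Ae hAd hAe hpk hR' hpR' (W S T)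
      (fun u => by rw [hXW, hXW]; exact hper S T u)
    simp only [hXW] at h3
    rw [div_mul_eq_mul_div, le_div_iff₀ hp1]
    calc (∑ b ∈ unitsR R', XL k X i Pd Ad Pe Ae (patWt k X i p S T Λ) b ^ 2) * ((p : ℝ) - 1)
        = 2 * (((p : ℝ) - 1) / 2 *
            ∑ b ∈ unitsR R', XL k X i Pd Ad Pe Ae (patWt k X i p S T Λ) b ^ 2) := by ring
      _ ≤ 2 * ∑ u ∈ unitsR (p * R'), XL k X i Pd Ad Pe Ae (W S T) u ^ 2 := by
          linarith [h3]
  refine h1.trans ?_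
  have h4 : (4 : ℝ) ^ k * ∑ S ∈ (Finset.univ : Finset (Fin k)).powerset,
        ∑ T ∈ (Finset.univ : Finset (Fin k)).powerset,
          ∑ u ∈ (unitsR (p * R')).filter (fun u => u % p = c),
            XL k X i Pd Ad Pe Ae (patWt k X i p S T Λ) u ^ 2 ≤
      (4 : ℝ) ^ k * ∑ S ∈ (Finset.univ : Finset (Fin k)).powerset,
        ∑ T ∈ (Finset.univ : Finset (Fin k)).powerset,
          (2 / ((p : ℝ) - 1)) *
            ∑ u ∈ unitsR (p * R'), XL k X i Pd Ad Pe Ae (W S T) u ^ 2 :=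
    mul_le_mul_of_nonneg_left (Finset.sum_le_sum fun S _ => Finset.sum_le_sum fun T _ => h2 S T)
      (by positivity)
  refine h4.trans (le_of_eq ?_)
  rw [Finset.mul_sum, Finset.mul_sum]
  refine Finset.sum_congr rfl fun S _ => ?_
  rw [Finset.mul_sum, Finset.mul_sum]
  refine Finset.sum_congr rfl fun T _ => ?_
  ring

/-- **The class bound in the Lemma 7 model, with arbitrary admissible extensions**: as
`sum_filter_mod_Xwt_sq_le_totient_mul_Qform`, with `Λ^{[S,T]}` replaced by admissible weights
`W_{S,T}` whose `p`-free parts are the `p`-free pattern weights on `rbox²`: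
`Σ_{u ∈ U_R, u ≡ c (p)} X_Λ(u)² ≤ (2·4^k/(p−1)) · φ(R) · Σ_{S,T} Q(W_{S,T}, W_{S,T})`.
[cite: Maynard2016LargeGaps, Lemma 7 (proof, displays (6.32)–(6.33))] -/
theorem sum_filter_mod_Xwt_sq_le_totient_mul_Qform_of_pfPart {x m p₀ : ℕ} (hp₀ : p₀.Prime)
    (hm : 1 ≤ m) {i : Fin k}
    (hacop : ∀ j, j ≠ i → IsCoprime ((m : ℤ) * p₀ - 1) ((hTuple k x j : ℤ) - hTuple k x i))
    {Λ : (Fin k → ℕ) → (Fin k → ℕ) → ℝ} (hΛ : AdmWt k m p₀ Λ)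
    {p : ℕ} (hp : p.Prime) (hpk : 4 * (k - 1) ≤ p - 1) (hpm : ¬ p ∣ m)
    (hph : ∀ j, j ≠ i → ¬ (p : ℤ) ∣ (hTuple k x j : ℤ) - hTuple k x i)
    {R' : ℕ} (hR : Squarefree (p * R')) (hxR : ∀ n, Squarefree n → n ≤ x → n ∣ p * R')
    {c : ℕ} (hc : c ∈ unitsR p)
    (W : Finset (Fin k) → Finset (Fin k) → (Fin k → ℕ) → (Fin k → ℕ) → ℝ)
    (hWadm : ∀ S T, AdmWt k m p₀ (W S T))
    (hW : ∀ S T, ∀ d ∈ rbox k x i, ∀ e ∈ rbox k x i,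
      pfPart p (W S T) d e = patWt k x i p S T Λ d e) :
    ∑ u ∈ (unitsR (p * R')).filter (fun u => u % p = c), Xwt k x m p₀ i Λ u ^ 2 ≤
      (2 * (4 : ℝ) ^ k / (p - 1 : ℝ)) * (Nat.totient (p * R') : ℝ) *
        ∑ S ∈ (Finset.univ : Finset (Fin k)).powerset, ∑ T ∈ (Finset.univ : Finset (Fin k)).powerset,
          Qform k x m p₀ i (W S T) (W S T) := by
  have hR' : R' ≠ 0 := fun h => by rw [h, mul_zero] at hR; exact not_squarefree_zero hR
  have hpR' : Nat.Coprime p R' := Nat.coprime_of_squarefree_mul hR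
  have hdiv : ∀ n, Squarefree n → n ≤ x → ¬ p ∣ n → n ∣ R' := by
    intro n hn hnx hpn
    exact ((Nat.Prime.coprime_iff_not_dvd hp).2 hpn).symm.dvd_of_dvd_mul_left (hxR n hn hnx)
  obtain ⟨hAd, hAe⟩ := sysA_not_dvd (k := k) (x := x) hp hpm hph
  have hΛsq : ∀ d e, Λ d e ≠ 0 → (∀ j, Squarefree (d j)) ∧ ∀ j, Squarefree (e j) :=
    fun d e h => ⟨(hΛ d e h).1, (hΛ d e h).2.1⟩
  have h1 := sum_filter_mod_XL_sq_le_of_pfPart hp (X := x) (fun j => sysP k m p₀ (Sum.inl j))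
    (fun j => sysA k x i m (Sum.inl j)) (fun j => sysP k m p₀ (Sum.inr j))
    (fun j => sysA k x i m (Sum.inr j)) hAd hAe hpk hR' hpR' hdiv hc hΛsq W hW
  have e : ∀ (W : (Fin k → ℕ) → (Fin k → ℕ) → ℝ) (u : ℕ),
      XL k x i (fun j => sysP k m p₀ (Sum.inl j)) (fun j => sysA k x i m (Sum.inl j))
        (fun j => sysP k m p₀ (Sum.inr j)) (fun j => sysA k x i m (Sum.inr j)) W u =
      Xwt k x m p₀ i W u := fun W u => (Xwt_eq_XL W u).symm
  simp only [e] at h1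
  refine h1.trans (le_of_eq ?_)
  rw [mul_assoc]
  congr 1
  rw [Finset.mul_sum]
  refine Finset.sum_congr rfl fun S _ => ?_
  rw [Finset.mul_sum]
  refine Finset.sum_congr rfl fun T _ => ?_
  rw [mul_comm (Nat.totient (p * R') : ℝ), Qform_mul_totient_eq_sum_unitsR hp₀ hm hacop
    (hWadm S T) (hWadm S T) hR hxR]
  exact Finset.sum_congr rfl fun u _ => by ring

/-! ### Sieve weights with slot-dependent cutoffs on both sides -/

variable {J : ℕ}

/-- `λ̃_{d,e} = (∏ μ(d_ℓ) μ(e_ℓ)) Σ_j c_j ∏_ℓ F_{ℓ,j}(log d_ℓ/log x) G_ℓ(log e_ℓ/log y)`: the weights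
(5.3) with a slot-dependent cutoff on the `e`-side too (needed for the translated weights).
[cite: Maynard2016LargeGaps, §5 display (5.3); Lemma 7 (proof, before (6.33))] -/
def lamG (c : Fin J → ℝ) (Fd : Fin k → Fin J → ℝ → ℝ) (Gs : Fin k → ℝ → ℝ) (ε : ℝ) (x : ℕ)
    (d e : Fin k → ℕ) : ℝ :=
  (∏ i, ((μ (d i) : ℤ) : ℝ) * ((μ (e i) : ℤ) : ℝ)) *
    ∑ j, c j * ∏ ℓ, Fd ℓ j (Real.log (d ℓ) / Real.log x) * Gs ℓ (Real.log (e ℓ) / Real.log (y ε x))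

/-- `λ = λ̃` for the constant family `G_ℓ = G`. [cite: Maynard2016LargeGaps, §5 display (5.3)] -/
theorem lam_eq_lamG (c : Fin J → ℝ) (Fd : Fin k → Fin J → ℝ → ℝ) (G : ℝ → ℝ) (ε : ℝ) (x : ℕ) :
    lam c Fd G ε x = lamG c Fd (fun _ => G) ε x := rfl

/-- The support hypotheses on the cutoffs: (5.4) on the `F`-side, support in `[0,1]` on the
`G`-side. [cite: Maynard2016LargeGaps, §5 displays (5.3)–(5.4)] -/
structure SuppG (k J : ℕ) (Fd : Fin k → Fin J → ℝ → ℝ) (Gs : Fin k → ℝ → ℝ) : Prop where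
  Fd_support : ∀ j (u : Fin k → ℝ), (∀ ℓ, 0 ≤ u ℓ) → (∀ ℓ, Fd ℓ j (u ℓ) ≠ 0) →
    ∑ ℓ, u ℓ ≤ 1 / 10
  G_support : ∀ ℓ (u : ℝ), 1 < u → Gs ℓ u = 0

/-- Sieve data satisfy the support hypotheses. [cite: Maynard2016LargeGaps, §5 displays (5.3)–(5.4)] -/
theorem IsSieveData.suppG {c : Fin J → ℝ} {Fd : Fin k → Fin J → ℝ → ℝ} {G : ℝ → ℝ}
    (hD : IsSieveData k J c Fd G) : SuppG k J Fd (fun _ => G) :=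
  ⟨hD.Fd_support, fun _ u hu => hD.G_support u hu⟩

/-- The support hypotheses only see the cutoffs on `[0, ∞)`. [cite: Maynard2016LargeGaps, §5 displays (5.3)–(5.4)] -/
theorem SuppG.congr_nonneg {Fd Fd' : Fin k → Fin J → ℝ → ℝ} {Gs Gs' : Fin k → ℝ → ℝ}
    (hS : SuppG k J Fd Gs) (hF : ∀ ℓ j t, 0 ≤ t → Fd' ℓ j t = Fd ℓ j t)
    (hG : ∀ ℓ t, 0 ≤ t → Gs' ℓ t = Gs ℓ t) : SuppG k J Fd' Gs' := by
  refine ⟨fun j u hu hne => hS.Fd_support j u hu fun ℓ => ?_, fun ℓ u hu => ?_⟩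
  · rw [← hF ℓ j (u ℓ) (hu ℓ)]; exact hne ℓ
  · rw [hG ℓ u (by linarith)]; exact hS.G_support ℓ u hu

/-- Translated `F`-cutoffs `F_{ℓ,j}(t + σ_ℓ)`. [cite: Maynard2016LargeGaps, Lemma 7 (proof, before (6.33))] -/
def trF (σ : Fin k → ℝ) (Fd : Fin k → Fin J → ℝ → ℝ) : Fin k → Fin J → ℝ → ℝ :=
  fun ℓ j t => Fd ℓ j (t + σ ℓ)

/-- Translated `G`-cutoffs `G_ℓ(t + τ_ℓ)`. [cite: Maynard2016LargeGaps, Lemma 7 (proof, before (6.33))] -/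
def trG (τ : Fin k → ℝ) (Gs : Fin k → ℝ → ℝ) : Fin k → ℝ → ℝ :=
  fun ℓ t => Gs ℓ (t + τ ℓ)

/-- `trF 0 = id`. [cite: Maynard2016LargeGaps, Lemma 7 (proof, before (6.33))] -/
@[simp] theorem trF_zero (Fd : Fin k → Fin J → ℝ → ℝ) : trF (fun _ => (0 : ℝ)) Fd = Fd := by
  funext ℓ j t; simp [trF]

/-- `trG 0 = id`. [cite: Maynard2016LargeGaps, Lemma 7 (proof, before (6.33))] -/
@[simp] theorem trG_zero (Gs : Fin k → ℝ → ℝ) : trG (fun _ => (0 : ℝ)) Gs = Gs := by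
  funext ℓ t; simp [trG]

/-- On the support of `λ̃` all `μ(d_ℓ), μ(e_ℓ)` are non-zero. [cite: Maynard2016LargeGaps, §5 display (5.3)] -/
theorem squarefree_of_lamG_ne_zero {c : Fin J → ℝ} {Fd : Fin k → Fin J → ℝ → ℝ}
    {Gs : Fin k → ℝ → ℝ} {ε : ℝ} {x : ℕ} {d e : Fin k → ℕ} (h : lamG c Fd Gs ε x d e ≠ 0)
    (i : Fin k) : Squarefree (d i) ∧ Squarefree (e i) := by
  unfold lamG at h
  have hprod := left_ne_zero_of_mul h
  have hi := (Finset.prod_ne_zero_iff.1 hprod) i (Finset.mem_univ i)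
  constructor
  · apply ArithmeticFunction.moebius_ne_zero_iff_squarefree.1
    intro h0
    apply hi
    simp [h0]
  · apply ArithmeticFunction.moebius_ne_zero_iff_squarefree.1
    intro h0
    apply hi
    simp [h0]

/-- On the support of `λ̃` some `j` has all cutoff factors non-zero. [cite: Maynard2016LargeGaps, §5 display (5.3)] -/
theorem exists_forall_ne_zero_of_lamG_ne_zero {c : Fin J → ℝ} {Fd : Fin k → Fin J → ℝ → ℝ}
    {Gs : Fin k → ℝ → ℝ} {ε : ℝ} {x : ℕ} {d e : Fin k → ℕ} (h : lamG c Fd Gs ε x d e ≠ 0) :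
    ∃ j, ∀ ℓ, Fd ℓ j (Real.log (d ℓ) / Real.log x) ≠ 0 ∧
      Gs ℓ (Real.log (e ℓ) / Real.log (y ε x)) ≠ 0 := by
  unfold lamG at h
  obtain ⟨j, -, hj⟩ := Finset.exists_ne_zero_of_sum_ne_zero (right_ne_zero_of_mul h)
  have hprod := right_ne_zero_of_mul hj
  refine ⟨j, fun ℓ => ?_⟩
  have hℓ := (Finset.prod_ne_zero_iff.1 hprod) ℓ (Finset.mem_univ ℓ)
  exact ⟨left_ne_zero_of_mul hℓ, right_ne_zero_of_mul hℓ⟩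

/-- **(5.4) for translated weights**: on the support of `λ̃` with cutoffs `F(· + σ)`, `σ ≥ 0`,
`Σ_ℓ (log d_ℓ/log x + σ_ℓ) ≤ 1/10`. [cite: Maynard2016LargeGaps, §5 display (5.4); Lemma 7 (proof, before (6.33))] -/
theorem sum_add_le_of_lamG_tr_ne_zero {c : Fin J → ℝ} {Fd : Fin k → Fin J → ℝ → ℝ}
    {Gs : Fin k → ℝ → ℝ} (hS : SuppG k J Fd Gs) {σ τ : Fin k → ℝ} (hσ : ∀ ℓ, 0 ≤ σ ℓ) {ε : ℝ}
    {x : ℕ} (hlogx : 0 < Real.log x) {d e : Fin k → ℕ} (hd : ∀ ℓ, 1 ≤ d ℓ)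
    (h : lamG c (trF σ Fd) (trG τ Gs) ε x d e ≠ 0) :
    ∑ ℓ, (Real.log (d ℓ) / Real.log x + σ ℓ) ≤ 1 / 10 := by
  obtain ⟨j, hj⟩ := exists_forall_ne_zero_of_lamG_ne_zero h
  exact hS.Fd_support j (fun ℓ => Real.log (d ℓ) / Real.log x + σ ℓ)
    (fun ℓ => add_nonneg (div_nonneg (Real.log_nonneg (by exact_mod_cast hd ℓ)) hlogx.le) (hσ ℓ))
    (fun ℓ => (hj ℓ).1)

/-- Each term of (5.4) for translated weights: `log d_ℓ/log x + σ_ℓ ≤ 1/10`.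
[cite: Maynard2016LargeGaps, §5 display (5.4); Lemma 7 (proof, before (6.33))] -/
theorem add_le_of_lamG_tr_ne_zero {c : Fin J → ℝ} {Fd : Fin k → Fin J → ℝ → ℝ}
    {Gs : Fin k → ℝ → ℝ} (hS : SuppG k J Fd Gs) {σ τ : Fin k → ℝ} (hσ : ∀ ℓ, 0 ≤ σ ℓ) {ε : ℝ}
    {x : ℕ} (hlogx : 0 < Real.log x) {d e : Fin k → ℕ} (hd : ∀ ℓ, 1 ≤ d ℓ)
    (h : lamG c (trF σ Fd) (trG τ Gs) ε x d e ≠ 0) (ℓ : Fin k) :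
    Real.log (d ℓ) / Real.log x + σ ℓ ≤ 1 / 10 := by
  have hnn : ∀ l, 0 ≤ Real.log (d l) / Real.log x + σ l := fun l =>
    add_nonneg (div_nonneg (Real.log_nonneg (by exact_mod_cast hd l)) hlogx.le) (hσ l)
  exact (Finset.single_le_sum (fun l _ => hnn l) (Finset.mem_univ ℓ)).trans
    (sum_add_le_of_lamG_tr_ne_zero hS hσ hlogx hd h)

/-- On the support of `λ̃` with cutoffs `G_ℓ(· + τ_ℓ)`: `log e_ℓ/log y + τ_ℓ ≤ 1`.
[cite: Maynard2016LargeGaps, §5 display (5.3); Lemma 7 (proof, before (6.33))] -/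
theorem add_le_one_of_lamG_tr_ne_zero {c : Fin J → ℝ} {Fd : Fin k → Fin J → ℝ → ℝ}
    {Gs : Fin k → ℝ → ℝ} (hS : SuppG k J Fd Gs) {σ τ : Fin k → ℝ} {ε : ℝ} {x : ℕ}
    {d e : Fin k → ℕ} (h : lamG c (trF σ Fd) (trG τ Gs) ε x d e ≠ 0) (ℓ : Fin k) :
    Real.log (e ℓ) / Real.log (y ε x) + τ ℓ ≤ 1 := by
  obtain ⟨j, hj⟩ := exists_forall_ne_zero_of_lamG_ne_zero h
  by_contra hlt
  push Not at hlt
  exact (hj ℓ).2 (hS.G_support ℓ _ hlt)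

/-- `log n / log Y ≤ a` with `n ≥ 1`, `log Y > 0` gives `n ≤ Y^a`. [cite: Maynard2016LargeGaps, §5 display (5.4)] -/
theorem natCast_le_rpow_of_log_div_le {n : ℕ} (hn : 1 ≤ n) {Y a : ℝ} (hY : 0 < Y)
    (hlogY : 0 < Real.log Y) (h : Real.log n / Real.log Y ≤ a) : (n : ℝ) ≤ Y ^ a := by
  have hn0 : (0 : ℝ) < n := by exact_mod_cast hn
  rw [div_le_iff₀ hlogY] at h
  rw [← Real.log_le_log_iff hn0 (Real.rpow_pos_of_pos hY a), Real.log_rpow hY]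
  exact h

/-- **Admissibility of the translated weights** (cf. `admWt_lam`): for `σ, τ ≥ 0` and large `x`
(`x < p₀`, `(m p₀ − 1, P_y) = 1`), the weight `s λ̃ · [rbox²]` with translated cutoffs is admissible.
[cite: Maynard2016LargeGaps, Lemma 7 (proof, (6.26) and before (6.33))] -/
theorem admWt_lamG_tr {c : Fin J → ℝ} {Fd : Fin k → Fin J → ℝ → ℝ} {Gs : Fin k → ℝ → ℝ}
    (hS : SuppG k J Fd Gs) {σ τ : Fin k → ℝ} (hσ : ∀ ℓ, 0 ≤ σ ℓ) (hτ : ∀ ℓ, 0 ≤ τ ℓ) {ε : ℝ}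
    {x : ℕ} (hx1 : 1 ≤ x) (hlogx : 0 < Real.log x) (hlogy : 0 < Real.log (y ε x)) {m p₀ : ℕ}
    (hxp : x < p₀) (hcop : Nat.Coprime (m * p₀ - 1) (primorial ⌊y ε x⌋₊)) (i : Fin k) (s : ℝ) :
    AdmWt k m p₀ (fun d e => if d ∈ rbox k x i ∧ e ∈ rbox k x i then
      s * lamG c (trF σ Fd) (trG τ Gs) ε x d e else 0) := by
  intro d e h
  dsimp only at h
  by_cases hde : d ∈ rbox k x i ∧ e ∈ rbox k x i
  · rw [if_pos hde] at h
    have hl : lamG c (trF σ Fd) (trG τ Gs) ε x d e ≠ 0 := right_ne_zero_of_mul h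
    have hbd := fun ℓ => Finset.mem_Icc.1 (Fintype.mem_piFinset.1 (mem_rbox.1 hde.1).1 ℓ)
    have hbe := fun ℓ => Finset.mem_Icc.1 (Fintype.mem_piFinset.1 (mem_rbox.1 hde.2).1 ℓ)
    have hx0 : (0 : ℝ) < x := by exact_mod_cast (show 0 < x by omega)
    have hx1' : (1 : ℝ) ≤ x := by exact_mod_cast hx1
    have hy0 : 0 < y ε x := by unfold y; exact Real.exp_pos _
    refine ⟨fun j => (squarefree_of_lamG_ne_zero hl j).1, fun j => (squarefree_of_lamG_ne_zero hl j).2,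
      fun j => ?_, fun j => ?_⟩
    · -- `d_j ≤ x^{1/10}`, so `d_j² ≤ x^{1/5} ≤ x < p₀`
      have h1 : Real.log (d j) / Real.log x ≤ 1 / 10 := by
        have := add_le_of_lamG_tr_ne_zero hS hσ hlogx (fun ℓ => (hbd ℓ).1) hl j
        linarith [hσ j]
      have h2 : (d j : ℝ) ≤ (x : ℝ) ^ (1 / 10 : ℝ) :=
        natCast_le_rpow_of_log_div_le (hbd j).1 hx0 hlogx h1
      have h3 : ((d j * d j : ℕ) : ℝ) ≤ (x : ℝ) ^ (1 / 10 : ℝ) * (x : ℝ) ^ (1 / 10 : ℝ) := by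
        push_cast
        exact mul_le_mul h2 h2 (Nat.cast_nonneg _) (Real.rpow_nonneg hx0.le _)
      have h4 : (x : ℝ) ^ (1 / 10 : ℝ) * (x : ℝ) ^ (1 / 10 : ℝ) ≤ x := by
        rw [← Real.rpow_add hx0]
        calc (x : ℝ) ^ (1 / 10 + 1 / 10 : ℝ) ≤ (x : ℝ) ^ (1 : ℝ) :=
              Real.rpow_le_rpow_of_exponent_le hx1' (by norm_num)
          _ = x := Real.rpow_one _
      have h5 : ((d j * d j : ℕ) : ℝ) < p₀ := lt_of_le_of_lt (h3.trans h4) (by exact_mod_cast hxp)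
      exact_mod_cast h5
    · -- `e_j ≤ y`, so `(m p₀ − 1, e_j) = 1`
      have h1 : Real.log (e j) / Real.log (y ε x) ≤ 1 := by
        have := add_le_one_of_lamG_tr_ne_zero hS hl j
        linarith [hτ j]
      have h2 : (e j : ℝ) ≤ y ε x := by
        have := natCast_le_rpow_of_log_div_le (hbe j).1 hy0 hlogy h1
        rwa [Real.rpow_one] at this
      have he0 : e j ≠ 0 := by have := (hbe j).1; omega
      exact coprime_of_le_of_coprime_primorial hcop he0 h2
  · rw [if_neg hde] at h
    exact absurd rfl h

/-! ### The pattern weights of `λ` are translated weights -/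

/-- The `F`-side translation of a pattern `S`: `σ_ℓ = [ℓ ∈ S] log p / log x`.
[cite: Maynard2016LargeGaps, Lemma 7 (proof, before (6.33))] -/
def sigmaP (p x : ℕ) (S : Finset (Fin k)) : Fin k → ℝ :=
  fun ℓ => if ℓ ∈ S then Real.log p / Real.log x else 0

/-- The `G`-side translation of a pattern `T`: `τ_ℓ = [ℓ ∈ T] log p / log y`.
[cite: Maynard2016LargeGaps, Lemma 7 (proof, before (6.33))] -/
def tauP (p : ℕ) (ε : ℝ) (x : ℕ) (T : Finset (Fin k)) : Fin k → ℝ :=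
  fun ℓ => if ℓ ∈ T then Real.log p / Real.log (y ε x) else 0

/-- `σ ≥ 0` (for `x ≥ 1`). [cite: Maynard2016LargeGaps, Lemma 7 (proof, before (6.33))] -/
theorem sigmaP_nonneg (p : ℕ) {x : ℕ} (hlogx : 0 < Real.log x) (S : Finset (Fin k)) (ℓ : Fin k) :
    0 ≤ sigmaP p x S ℓ := by
  unfold sigmaP
  split_ifs
  · exact div_nonneg (Real.log_natCast_nonneg p) hlogx.le
  · exact le_rfl

/-- `τ ≥ 0`. [cite: Maynard2016LargeGaps, Lemma 7 (proof, before (6.33))] -/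
theorem tauP_nonneg (p : ℕ) {ε : ℝ} {x : ℕ} (hlogy : 0 < Real.log (y ε x)) (T : Finset (Fin k))
    (ℓ : Fin k) : 0 ≤ tauP p ε x T ℓ := by
  unfold tauP
  split_ifs
  · exact div_nonneg (Real.log_natCast_nonneg p) hlogy.le
  · exact le_rfl

/-- `μ(p n) = −μ(n)` for a prime `p ∤ n`. [cite: Maynard2016LargeGaps, Lemma 7 (proof, before (6.33))] -/
theorem moebius_prime_mul {p n : ℕ} (hp : p.Prime) (hn : ¬ p ∣ n) : μ (p * n) = -μ n := by
  rw [ArithmeticFunction.isMultiplicative_moebius.map_mul_of_coprime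
    ((Nat.Prime.coprime_iff_not_dvd hp).2 hn), ArithmeticFunction.moebius_apply_prime hp]
  ring

/-- Rearranging the sign factors of one term. [cite: Maynard2016LargeGaps, Lemma 7 (proof, before (6.33))] -/
private theorem prod_sign_rearrange (a b u v : Fin k → ℝ) :
    ∏ ℓ, (a ℓ * u ℓ) * (b ℓ * v ℓ) = (∏ ℓ, a ℓ) * (∏ ℓ, b ℓ) * ∏ ℓ, u ℓ * v ℓ := by
  rw [← Finset.prod_mul_distrib, ← Finset.prod_mul_distrib]
  exact Finset.prod_congr rfl fun ℓ _ => by ring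

/-- `∏_ℓ (if ℓ ∈ S then −1 else 1) = (−1)^{|S|}`. [cite: Maynard2016LargeGaps, Lemma 7 (proof, before (6.33))] -/
private theorem prod_ite_neg_one (S : Finset (Fin k)) :
    ∏ ℓ, (if ℓ ∈ S then (-1 : ℝ) else 1) = (-1) ^ S.card := by
  rw [Finset.prod_ite_mem, Finset.univ_inter, Finset.prod_const]

/-- **The pattern weights are translated weights**: for a prime `p` with `p ∤ d_ℓ, p ∤ e_ℓ` (all
`d_ℓ, e_ℓ ≥ 1`) and cutoffs `F̃, G̃` agreeing with `F, G` on `[0, ∞)`,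
`λ_{p^S d, p^T e} = (−1)^{|S|+|T|} · λ̃_{d,e}`, `λ̃` the weight with cutoffs
`F̃_{ℓ,j}(t + [ℓ∈S] log p/log x)`, `G̃(t + [ℓ∈T] log p/log y)`.
[cite: Maynard2016LargeGaps, Lemma 7 (proof, before (6.33))] -/
theorem lam_scaleAt_eq {c : Fin J → ℝ} {Fd Fd' : Fin k → Fin J → ℝ → ℝ} {G G' : ℝ → ℝ}
    (hF : ∀ ℓ j t, 0 ≤ t → Fd' ℓ j t = Fd ℓ j t) (hG : ∀ t, 0 ≤ t → G' t = G t) {ε : ℝ} {x : ℕ}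
    (hlogx : 0 < Real.log x) (hlogy : 0 < Real.log (y ε x)) {p : ℕ} (hp : p.Prime)
    (S T : Finset (Fin k)) {d e : Fin k → ℕ} (hd : ∀ ℓ, 1 ≤ d ℓ) (he : ∀ ℓ, 1 ≤ e ℓ)
    (hpd : PFree p d) (hpe : PFree p e) :
    lam c Fd G ε x (scaleAt p S d) (scaleAt p T e) =
      (-1) ^ (S.card + T.card) *
        lamG c (trF (sigmaP p x S) Fd') (trG (tauP p ε x T) (fun _ => G')) ε x d e := by
  have hp0 : (p : ℝ) ≠ 0 := by exact_mod_cast hp.ne_zero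
  -- the Möbius factors
  have hμd : ∀ ℓ, ((μ (scaleAt p S d ℓ) : ℤ) : ℝ) = (if ℓ ∈ S then (-1 : ℝ) else 1) * ((μ (d ℓ) : ℤ) : ℝ) := by
    intro ℓ
    unfold scaleAt
    split_ifs with h
    · rw [moebius_prime_mul hp (hpd ℓ)]; push_cast; ring
    · ring
  have hμe : ∀ ℓ, ((μ (scaleAt p T e ℓ) : ℤ) : ℝ) = (if ℓ ∈ T then (-1 : ℝ) else 1) * ((μ (e ℓ) : ℤ) : ℝ) := by
    intro ℓ
    unfold scaleAt
    split_ifs with h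
    · rw [moebius_prime_mul hp (hpe ℓ)]; push_cast; ring
    · ring
  -- the cutoff factors
  have hFd : ∀ ℓ j, Fd ℓ j (Real.log (scaleAt p S d ℓ) / Real.log x) =
      trF (sigmaP p x S) Fd' ℓ j (Real.log (d ℓ) / Real.log x) := by
    intro ℓ j
    have hd0 : (d ℓ : ℝ) ≠ 0 := by have := hd ℓ; positivity
    have ht : 0 ≤ Real.log (d ℓ) / Real.log x :=
      div_nonneg (Real.log_nonneg (by exact_mod_cast hd ℓ)) hlogx.le
    unfold trF sigmaP scaleAt
    split_ifs with h
    · rw [hF ℓ j _ (add_nonneg ht (div_nonneg (Real.log_natCast_nonneg p) hlogx.le))]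
      push_cast
      rw [Real.log_mul hp0 hd0, add_div, add_comm]
    · rw [add_zero, hF ℓ j _ ht]
  have hGe : ∀ ℓ, G (Real.log (scaleAt p T e ℓ) / Real.log (y ε x)) =
      trG (tauP p ε x T) (fun _ => G') ℓ (Real.log (e ℓ) / Real.log (y ε x)) := by
    intro ℓ
    have he0 : (e ℓ : ℝ) ≠ 0 := by have := he ℓ; positivity
    have ht : 0 ≤ Real.log (e ℓ) / Real.log (y ε x) :=
      div_nonneg (Real.log_nonneg (by exact_mod_cast he ℓ)) hlogy.le
    simp only [trG, tauP, scaleAt]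
    split_ifs with h
    · rw [hG _ (add_nonneg ht (div_nonneg (Real.log_natCast_nonneg p) hlogy.le))]
      push_cast
      rw [Real.log_mul hp0 he0, add_div, add_comm]
    · rw [add_zero, hG _ ht]
  unfold lam lamG
  simp_rw [hμd, hμe, hFd, hGe]
  rw [prod_sign_rearrange, prod_ite_neg_one, prod_ite_neg_one, pow_add]
  ring

/-- **The smooth pattern weight** `W_{S,T}(d,e) = [d, e ∈ rbox] · s · λ̃_{d,e}` with translated
cutoffs (`s = (−1)^{|S|+|T|}` in the application). [cite: Maynard2016LargeGaps, Lemma 7 (proof, before (6.33))] -/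
def smoothWt (c : Fin J → ℝ) (Fd : Fin k → Fin J → ℝ → ℝ) (Gs : Fin k → ℝ → ℝ) (ε : ℝ)
    (x : ℕ) (i : Fin k) (s : ℝ) (σ τ : Fin k → ℝ) : (Fin k → ℕ) → (Fin k → ℕ) → ℝ :=
  fun d e => if d ∈ rbox k x i ∧ e ∈ rbox k x i then s * lamG c (trF σ Fd) (trG τ Gs) ε x d e else 0

/-- On the support of the translated weight (pattern `(S, T)`, `d, e ∈ rbox`, `i ∉ S ∪ T`, `y ≤ x`)
the scaled tuples `p^S d`, `p^T e` lie in `rbox` again. [cite: Maynard2016LargeGaps, Lemma 7 (proof, before (6.33))] -/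
theorem scaleAt_mem_rbox_of_lamG_tr_ne_zero {c : Fin J → ℝ} {Fd : Fin k → Fin J → ℝ → ℝ}
    {Gs : Fin k → ℝ → ℝ} (hS : SuppG k J Fd Gs) {ε : ℝ} {x : ℕ} (hx1 : 1 ≤ x)
    (hlogx : 0 < Real.log x) (hlogy : 0 < Real.log (y ε x)) (hyx : y ε x ≤ x) {p : ℕ}
    (hp : p.Prime) {i : Fin k} {S T : Finset (Fin k)} (hiS : i ∉ S) (hiT : i ∉ T)
    {d e : Fin k → ℕ} (hd : d ∈ rbox k x i) (he : e ∈ rbox k x i)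
    (h : lamG c (trF (sigmaP p x S) Fd) (trG (tauP p ε x T) Gs) ε x d e ≠ 0) :
    scaleAt p S d ∈ rbox k x i ∧ scaleAt p T e ∈ rbox k x i := by
  have hbd := fun ℓ => Finset.mem_Icc.1 (Fintype.mem_piFinset.1 (mem_rbox.1 hd).1 ℓ)
  have hbe := fun ℓ => Finset.mem_Icc.1 (Fintype.mem_piFinset.1 (mem_rbox.1 he).1 ℓ)
  have hx0 : (0 : ℝ) < x := by exact_mod_cast (show 0 < x by omega)
  have hy0 : 0 < y ε x := by unfold y; exact Real.exp_pos _
  have hp0 : (p : ℝ) ≠ 0 := by exact_mod_cast hp.ne_zero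
  refine ⟨mem_rbox.2 ⟨Fintype.mem_piFinset.2 fun ℓ => Finset.mem_Icc.2 ?_, ?_⟩,
    mem_rbox.2 ⟨Fintype.mem_piFinset.2 fun ℓ => Finset.mem_Icc.2 ?_, ?_⟩⟩
  · unfold scaleAt
    split_ifs with hℓ
    · refine ⟨le_trans (hbd ℓ).1 (Nat.le_mul_of_pos_left _ hp.pos), ?_⟩
      -- `log d_ℓ/log x + log p/log x ≤ 1/10 ≤ 1`, so `p d_ℓ ≤ x`
      have h1 := add_le_of_lamG_tr_ne_zero hS (sigmaP_nonneg p hlogx S) hlogx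
        (fun l => (hbd l).1) h ℓ
      simp only [sigmaP, if_pos hℓ] at h1
      have hd0 : (d ℓ : ℝ) ≠ 0 := by have := (hbd ℓ).1; positivity
      have h2 : Real.log ((p * d ℓ : ℕ) : ℝ) / Real.log x ≤ 1 := by
        push_cast
        rw [Real.log_mul hp0 hd0, add_div]
        linarith
      have h3 := natCast_le_rpow_of_log_div_le
        (le_trans (hbd ℓ).1 (Nat.le_mul_of_pos_left _ hp.pos)) hx0 hlogx h2
      rw [Real.rpow_one] at h3
      exact_mod_cast h3
    · exact hbd ℓ
  · show (if i ∈ S then p * d i else d i) = 1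
    rw [if_neg hiS, (mem_rbox.1 hd).2]
  · unfold scaleAt
    split_ifs with hℓ
    · refine ⟨le_trans (hbe ℓ).1 (Nat.le_mul_of_pos_left _ hp.pos), ?_⟩
      -- `log e_ℓ/log y + log p/log y ≤ 1`, so `p e_ℓ ≤ y ≤ x`
      have h1 := add_le_one_of_lamG_tr_ne_zero hS h ℓ
      simp only [tauP, if_pos hℓ] at h1
      have he0 : (e ℓ : ℝ) ≠ 0 := by have := (hbe ℓ).1; positivity
      have h2 : Real.log ((p * e ℓ : ℕ) : ℝ) / Real.log (y ε x) ≤ 1 := by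
        push_cast
        rw [Real.log_mul hp0 he0, add_div]
        linarith
      have h3 := natCast_le_rpow_of_log_div_le
        (le_trans (hbe ℓ).1 (Nat.le_mul_of_pos_left _ hp.pos)) hy0 hlogy h2
      rw [Real.rpow_one] at h3
      exact_mod_cast (h3.trans hyx)
    · exact hbe ℓ
  · show (if i ∈ T then p * e i else e i) = 1
    rw [if_neg hiT, (mem_rbox.1 he).2]

/-- **The `p`-free part of the smooth pattern weight is the `p`-free pattern weight**: for a prime
`p`, `i ∉ S ∪ T`, `y ≤ x`, cutoffs `F̃, G̃` agreeing with `F, G` on `[0,∞)` and satisfying the support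
hypotheses, and `d, e ∈ rbox`:
`(W_{S,T})^{pf}(d,e) = Λ^{(S,T)}(d,e)` with `Λ = λ · [rbox²]`, `W_{S,T} = (−1)^{|S|+|T|} λ̃ · [rbox²]`.
[cite: Maynard2016LargeGaps, Lemma 7 (proof, before (6.33))] -/
theorem pfPart_smoothWt_eq_patWt {c : Fin J → ℝ} {Fd Fd' : Fin k → Fin J → ℝ → ℝ} {G G' : ℝ → ℝ}
    (hS : SuppG k J Fd' (fun _ => G'))
    (hF : ∀ ℓ j t, 0 ≤ t → Fd' ℓ j t = Fd ℓ j t) (hG : ∀ t, 0 ≤ t → G' t = G t) {ε : ℝ} {x : ℕ}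
    (hx1 : 1 ≤ x) (hlogx : 0 < Real.log x) (hlogy : 0 < Real.log (y ε x)) (hyx : y ε x ≤ x)
    {p : ℕ} (hp : p.Prime) {i : Fin k} {S T : Finset (Fin k)} (hiS : i ∉ S) (hiT : i ∉ T)
    {d e : Fin k → ℕ} (hd : d ∈ rbox k x i) (he : e ∈ rbox k x i) :
    pfPart p (smoothWt c Fd' (fun _ => G') ε x i ((-1) ^ (S.card + T.card))
        (sigmaP p x S) (tauP p ε x T)) d e =
      patWt k x i p S T
        (fun d e => if d ∈ rbox k x i ∧ e ∈ rbox k x i then lam c Fd G ε x d e else 0) d e := by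
  have hbd := fun ℓ => (Finset.mem_Icc.1 (Fintype.mem_piFinset.1 (mem_rbox.1 hd).1 ℓ)).1
  have hbe := fun ℓ => (Finset.mem_Icc.1 (Fintype.mem_piFinset.1 (mem_rbox.1 he).1 ℓ)).1
  unfold pfPart patWt smoothWt
  by_cases hpf : PFree p d ∧ PFree p e
  · rw [if_pos hpf, if_pos (show d ∈ rbox k x i ∧ e ∈ rbox k x i from ⟨hd, he⟩)]
    by_cases hsc : scaleAt p S d ∈ rbox k x i ∧ scaleAt p T e ∈ rbox k x i
    · rw [if_pos (show (PFree p d ∧ scaleAt p S d ∈ rbox k x i) ∧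
          (PFree p e ∧ scaleAt p T e ∈ rbox k x i) from ⟨⟨hpf.1, hsc.1⟩, ⟨hpf.2, hsc.2⟩⟩)]
      dsimp only
      rw [if_pos hsc, lam_scaleAt_eq hF hG hlogx hlogy hp S T hbd hbe hpf.1 hpf.2]
    · rw [if_neg (show ¬ ((PFree p d ∧ scaleAt p S d ∈ rbox k x i) ∧
          (PFree p e ∧ scaleAt p T e ∈ rbox k x i)) from fun h => hsc ⟨h.1.2, h.2.2⟩)]
      by_contra hne
      have hl : lamG c (trF (sigmaP p x S) Fd') (trG (tauP p ε x T) (fun _ => G')) ε x d e ≠ 0 :=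
        right_ne_zero_of_mul hne
      exact hsc (scaleAt_mem_rbox_of_lamG_tr_ne_zero hS hx1 hlogx hlogy hyx hp hiS hiT hd he hl)
  · rw [if_neg hpf, if_neg (show ¬ ((PFree p d ∧ scaleAt p S d ∈ rbox k x i) ∧
        (PFree p e ∧ scaleAt p T e ∈ rbox k x i)) from fun h => hpf ⟨h.1.1, h.2.1⟩)]

/-- For `i ∈ S ∪ T` the pattern weight vanishes on `rbox²` (the `i`-th coordinate of `p^S d` is
`p ≠ 1`), so the zero weight is an extension. [cite: Maynard2016LargeGaps, Lemma 7 (proof, before (6.33))] -/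
theorem patWt_eq_zero_of_mem {p : ℕ} (hp : p.Prime) {X : ℕ} {i : Fin k} {S T : Finset (Fin k)}
    (hi : i ∈ S ∨ i ∈ T) (Λ : (Fin k → ℕ) → (Fin k → ℕ) → ℝ) {d e : Fin k → ℕ}
    (hd : d ∈ rbox k X i) (he : e ∈ rbox k X i) : patWt k X i p S T Λ d e = 0 := by
  unfold patWt
  rw [if_neg]
  rintro ⟨⟨-, hsd⟩, ⟨-, hse⟩⟩
  rcases hi with hi | hi
  · have h1 := (mem_rbox.1 hsd).2
    simp only [scaleAt, if_pos hi, (mem_rbox.1 hd).2, mul_one] at h1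
    exact hp.one_lt.ne' h1
  · have h1 := (mem_rbox.1 hse).2
    simp only [scaleAt, if_pos hi, (mem_rbox.1 he).2, mul_one] at h1
    exact hp.one_lt.ne' h1

/-- `(0)^{pf} = 0`. [cite: Maynard2016LargeGaps, Lemma 7 (proof, before (6.33))] -/
@[simp] theorem pfPart_zero (p : ℕ) : pfPart (k := k) p (fun _ _ => (0 : ℝ)) = fun _ _ => 0 := by
  funext d e; simp [pfPart]

/-- The zero weight is admissible. [cite: Maynard2016LargeGaps, Lemma 7 (proof, (6.26))] -/
theorem admWt_zero (k m p₀ : ℕ) : AdmWt k m p₀ (fun _ _ => (0 : ℝ)) := fun _ _ h => absurd rfl h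

/-- `Q(0, 0) = 0`. [cite: Maynard2016LargeGaps, Lemma 7 (proof, display (6.29))] -/
@[simp] theorem Qform_zero (k x m p₀ : ℕ) (i : Fin k) :
    Qform k x m p₀ i (fun _ _ => (0 : ℝ)) (fun _ _ => 0) = 0 := by
  simp [Qform]

/-! ### The quadratic form of a smooth weight as weighted coupled `lcm`-sums -/

/-- Rearranging the eight products of one `(j, j')`-term. [cite: Maynard2016LargeGaps, §6 display (6.32)] -/
private theorem prod_rearrange_mul' {ι : Type*} [Fintype ι] (c c' L : ℂ)
    (a₁ a₂ a₃ a₄ a₅ a₆ a₇ a₈ : ι → ℂ) :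
    (∏ i, a₁ i * a₂ i) * (c * ∏ i, a₃ i * a₄ i) * ((∏ i, a₅ i * a₆ i) * (c' * ∏ i, a₇ i * a₈ i)) * L =
      c * c' * ((∏ i, a₁ i * a₅ i * a₃ i * a₇ i) * (∏ i, a₂ i * a₆ i * a₄ i * a₈ i) * L) := by
  have h : (∏ i, a₁ i * a₂ i) * (∏ i, a₃ i * a₄ i) * ((∏ i, a₅ i * a₆ i) * ∏ i, a₇ i * a₈ i) =
      (∏ i, a₁ i * a₅ i * a₃ i * a₇ i) * ∏ i, a₂ i * a₆ i * a₄ i * a₈ i := by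
    simp only [← Finset.prod_mul_distrib]
    exact Finset.prod_congr rfl fun i _ => by ring
  calc (∏ i, a₁ i * a₂ i) * (c * ∏ i, a₃ i * a₄ i) * ((∏ i, a₅ i * a₆ i) * (c' * ∏ i, a₇ i * a₈ i)) * L
      = c * c' * ((∏ i, a₁ i * a₂ i) * (∏ i, a₃ i * a₄ i) *
          ((∏ i, a₅ i * a₆ i) * ∏ i, a₇ i * a₈ i) * L) := by ring
    _ = _ := by rw [h]

/-- `λ̃_{d,e} λ̃_{d',e'} · φ([d,d',e,e'])⁻¹ = Σ_j Σ_{j'} c_j c_{j'} coupledLcmTermW φ⁻¹ (F_{·,j}) (F_{·,j'}) G G …`.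
[cite: Maynard2016LargeGaps, §6 displays (6.8), (6.32)] -/
theorem ofReal_lamG_mul_lamG_mul_phiInv (c : Fin J → ℝ) (Fd : Fin k → Fin J → ℝ → ℝ)
    (Gs : Fin k → ℝ → ℝ) (ε : ℝ) (x : ℕ) (d d' e e' : Fin k → ℕ) :
    (lamG c Fd Gs ε x d e : ℂ) * (lamG c Fd Gs ε x d' e' : ℂ) *
        phiInv (Nat.lcm (∏ i, Nat.lcm (d i) (d' i)) (∏ i, Nat.lcm (e i) (e' i))) =
      ∑ j, ∑ j', (c j : ℂ) * c j' *
        coupledLcmTermW phiInv (fun ℓ => Fd ℓ j) (fun ℓ => Fd ℓ j') Gs Gs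
          (x : ℝ) (y ε x) (d, d') (e, e') := by
  rw [lamG, lamG]
  push_cast
  rw [Finset.mul_sum, Finset.mul_sum, Finset.sum_mul, Finset.sum_mul]
  refine Finset.sum_congr rfl fun j _ => ?_
  rw [Finset.mul_sum, Finset.sum_mul]
  refine Finset.sum_congr rfl fun j' _ => ?_
  rw [coupledLcmTermW]
  exact prod_rearrange_mul' _ _ _ _ _ _ _ _ _ _ _

open Classical in
/-- **One summand of `Q(W, W)` for a smooth weight** `W = s λ̃ · [rbox²]` (admissible):
for `d, d', e, e' ∈ rbox` and large `x`,
`W(d,e) W(d',e') mainCoeff(1) = s² [CoupledAdm …] Σ_j Σ_{j'} c_j c_{j'} coupledLcmTermW φ⁻¹ …`.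
[cite: Maynard2016LargeGaps, §6 display (6.32)] -/
theorem ofReal_smoothWt_summand_eq {c : Fin J → ℝ} {Fd : Fin k → Fin J → ℝ → ℝ}
    {Gs : Fin k → ℝ → ℝ} {ε : ℝ} {x : ℕ} {m p₀ : ℕ} (hp₀ : p₀.Prime) (hm : 1 ≤ m)
    (hW : ∀ a b : Fin k, a ≠ b → ∀ p : ℕ, p.Prime →
      (p : ℤ) ∣ (hTuple k x b : ℤ) - hTuple k x a → p ∣ Pw x)
    {i : Fin k} {s : ℝ} {σ τ : Fin k → ℝ} (hA : AdmWt k m p₀ (smoothWt c Fd Gs ε x i s σ τ))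
    {d d' e e' : Fin k → ℕ} (hd : d ∈ rbox k x i) (hd' : d' ∈ rbox k x i)
    (he : e ∈ rbox k x i) (he' : e' ∈ rbox k x i) :
    ((smoothWt c Fd Gs ε x i s σ τ d e * smoothWt c Fd Gs ε x i s σ τ d' e' *
        mainCoeff k x m p₀ i d d' e e' 1 : ℝ) : ℂ) =
      (s : ℂ) ^ 2 *
        if CoupledAdm (Pw x) m (couplingSet7 k x m p₀ i) (d, d') (e, e') then
          ∑ j, ∑ j', (c j : ℂ) * c j' *
            coupledLcmTermW phiInv (fun ℓ => trF σ Fd ℓ j) (fun ℓ => trF σ Fd ℓ j') (trG τ Gs)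
              (trG τ Gs) (x : ℝ) (y ε x) (d, d') (e, e')
        else 0 := by
  have hWde : smoothWt c Fd Gs ε x i s σ τ d e = s * lamG c (trF σ Fd) (trG τ Gs) ε x d e := by
    unfold smoothWt; rw [if_pos (show d ∈ rbox k x i ∧ e ∈ rbox k x i from ⟨hd, he⟩)]
  have hWde' : smoothWt c Fd Gs ε x i s σ τ d' e' = s * lamG c (trF σ Fd) (trG τ Gs) ε x d' e' := by
    unfold smoothWt; rw [if_pos (show d' ∈ rbox k x i ∧ e' ∈ rbox k x i from ⟨hd', he'⟩)]
  rw [← ofReal_lamG_mul_lamG_mul_phiInv]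
  by_cases hlam : lamG c (trF σ Fd) (trG τ Gs) ε x d e * lamG c (trF σ Fd) (trG τ Gs) ε x d' e' = 0
  · -- both sides vanish
    have h1 : smoothWt c Fd Gs ε x i s σ τ d e * smoothWt c Fd Gs ε x i s σ τ d' e' = 0 := by
      rw [hWde, hWde', show s * lamG c (trF σ Fd) (trG τ Gs) ε x d e *
        (s * lamG c (trF σ Fd) (trG τ Gs) ε x d' e') = s * s *
          (lamG c (trF σ Fd) (trG τ Gs) ε x d e * lamG c (trF σ Fd) (trG τ Gs) ε x d' e') by ring,
        hlam, mul_zero]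
    rw [h1, zero_mul, ← Complex.ofReal_mul, hlam]
    push_cast
    simp
  · by_cases hs : s = 0
    · rw [hWde, hs]
      push_cast
      simp
    have h1 : smoothWt c Fd Gs ε x i s σ τ d e ≠ 0 := by
      rw [hWde]; exact mul_ne_zero hs (left_ne_zero_of_mul hlam)
    have h2 : smoothWt c Fd Gs ε x i s σ τ d' e' ≠ 0 := by
      rw [hWde']; exact mul_ne_zero hs (right_ne_zero_of_mul hlam)
    obtain ⟨hsd, hsd', hse, hse', hdlt, hecop⟩ := hA.pair_hyps hA h1 h2
    have hdi := (mem_rbox.1 hd).2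
    have hdi' := (mem_rbox.1 hd').2
    have hei := (mem_rbox.1 he).2
    have hei' := (mem_rbox.1 he').2
    have h3 : smoothWt c Fd Gs ε x i s σ τ d e * smoothWt c Fd Gs ε x i s σ τ d' e' *
        mainCoeff k x m p₀ i d d' e e' 1 =
      if SysSolvable k x m p₀ i d d' e e' then
        s ^ 2 * (lamG c (trF σ Fd) (trG τ Gs) ε x d e * lamG c (trF σ Fd) (trG τ Gs) ε x d' e') /
          (Nat.totient (radMod d d' e e') : ℝ) else 0 := by
      rw [hWde, hWde', mainCoeff]
      split_ifs <;> ring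
    rw [h3, summand_sysSolvable_eq_coupledAdm hp₀ hm hW hsd hsd' hse hse' hdlt hecop hdi hdi' hei hei']
    split_ifs
    · rw [ofReal_div_totient]
      push_cast
      ring
    · push_cast
      ring

/-- Pushing the `(j, j')`-sums through a box sum. [cite: Maynard2016LargeGaps, §6 display (6.32)] -/
private theorem sum_sum_mul_sum_comm (c : Fin J → ℝ) (s : Finset (Fin k → ℕ))
    (T : Fin J → Fin J → (Fin k → ℕ) → ℂ) :
    ∑ j, ∑ j', (c j : ℂ) * c j' * ∑ v ∈ s, T j j' v =
      ∑ v ∈ s, ∑ j, ∑ j', (c j : ℂ) * c j' * T j j' v := by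
  calc ∑ j, ∑ j', (c j : ℂ) * c j' * ∑ v ∈ s, T j j' v
      = ∑ j, ∑ j', ∑ v ∈ s, (c j : ℂ) * c j' * T j j' v := by simp_rw [Finset.mul_sum]
    _ = ∑ j, ∑ v ∈ s, ∑ j', (c j : ℂ) * c j' * T j j' v :=
        Finset.sum_congr rfl fun j _ => Finset.sum_comm
    _ = ∑ v ∈ s, ∑ j, ∑ j', (c j : ℂ) * c j' * T j j' v := Finset.sum_comm

open Classical in
/-- **`Q(W, W)` of a smooth weight as weighted coupled `lcm`-sums on the free slots**: for
`W = s λ̃ · [rbox²]` admissible (translated cutoffs `F̃ = F(·+σ)`, `G̃ = G(·+τ)`) and large `x`,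
`Q(W, W) = s² Σ_j Σ_{j'} c_j c_{j'} · F̃_{i,j}(0) F̃_{i,j'}(0) G̃_i(0) G̃_i(0) ·
  coupledLcmSumW φ⁻¹ (P_w) m (restrictPairs i i (couplingSet7 p₀ i)) (F̃_{·,j}|) (F̃_{·,j'}|) (G̃|) (G̃|) x y x`.
[cite: Maynard2016LargeGaps, §6 display (6.32); Lemma 7 (proof, before (6.33))] -/
theorem ofReal_Qform_smoothWt_eq {c : Fin J → ℝ} {Fd : Fin k → Fin J → ℝ → ℝ}
    {Gs : Fin k → ℝ → ℝ} {ε : ℝ} {x : ℕ} (hx1 : 1 ≤ x) {m p₀ : ℕ} (hp₀ : p₀.Prime) (hm : 1 ≤ m)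
    (hW : ∀ a b : Fin k, a ≠ b → ∀ p : ℕ, p.Prime →
      (p : ℤ) ∣ (hTuple k x b : ℤ) - hTuple k x a → p ∣ Pw x)
    {i : Fin k} {s : ℝ} {σ τ : Fin k → ℝ} (hA : AdmWt k m p₀ (smoothWt c Fd Gs ε x i s σ τ)) :
    ((Qform k x m p₀ i (smoothWt c Fd Gs ε x i s σ τ) (smoothWt c Fd Gs ε x i s σ τ) : ℝ) : ℂ) =
      (s : ℂ) ^ 2 * ∑ j, ∑ j', (c j : ℂ) * c j' *
        ((trF σ Fd i j 0 : ℂ) * trF σ Fd i j' 0 * trG τ Gs i 0 * trG τ Gs i 0 *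
          coupledLcmSumW phiInv (Pw x) m (restrictPairs i i (couplingSet7 k x m p₀ i))
            (fun l : {l : Fin k // l ≠ i} => trF σ Fd l.1 j) (fun l => trF σ Fd l.1 j')
            (fun l => trG τ Gs l.1) (fun l => trG τ Gs l.1) (x : ℝ) (y ε x) x) := by
  classical
  have h0 : ((Qform k x m p₀ i (smoothWt c Fd Gs ε x i s σ τ) (smoothWt c Fd Gs ε x i s σ τ) : ℝ) : ℂ) =
      ∑ d ∈ rbox k x i, ∑ d' ∈ rbox k x i, ∑ e ∈ rbox k x i, ∑ e' ∈ rbox k x i,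
        (((smoothWt c Fd Gs ε x i s σ τ d e * smoothWt c Fd Gs ε x i s σ τ d' e' *
          mainCoeff k x m p₀ i d d' e e' 1 : ℝ)) : ℂ) := by
    unfold Qform
    push_cast
    rfl
  -- Step 1: rewrite each summand
  have h1 : ∑ d ∈ rbox k x i, ∑ d' ∈ rbox k x i, ∑ e ∈ rbox k x i, ∑ e' ∈ rbox k x i,
        (((smoothWt c Fd Gs ε x i s σ τ d e * smoothWt c Fd Gs ε x i s σ τ d' e' *
          mainCoeff k x m p₀ i d d' e e' 1 : ℝ)) : ℂ) =
      ∑ d ∈ rbox k x i, ∑ d' ∈ rbox k x i, ∑ e ∈ rbox k x i, ∑ e' ∈ rbox k x i,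
        ((s : ℂ) ^ 2 *
          if CoupledAdm (Pw x) m (couplingSet7 k x m p₀ i) (d, d') (e, e') then
            ∑ j, ∑ j', (c j : ℂ) * c j' *
              coupledLcmTermW phiInv (fun ℓ => trF σ Fd ℓ j) (fun ℓ => trF σ Fd ℓ j') (trG τ Gs)
                (trG τ Gs) (x : ℝ) (y ε x) (d, d') (e, e')
          else 0) :=
    Finset.sum_congr rfl fun d hd => Finset.sum_congr rfl fun d' hd' =>
      Finset.sum_congr rfl fun e he => Finset.sum_congr rfl fun e' he' =>
        ofReal_smoothWt_summand_eq hp₀ hm hW hA hd hd' he he'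
  rw [h0, h1]
  simp only [← Finset.mul_sum]
  refine congrArg (HMul.hMul ((s : ℂ) ^ 2)) ?_
  -- Step 2: exchange the `(j, j')`-sums with the box sums and use (6.32) on the free slots
  have key : ∀ j j', (trF σ Fd i j 0 : ℂ) * trF σ Fd i j' 0 * trG τ Gs i 0 * trG τ Gs i 0 *
      coupledLcmSumW phiInv (Pw x) m (restrictPairs i i (couplingSet7 k x m p₀ i))
        (fun l : {l : Fin k // l ≠ i} => trF σ Fd l.1 j) (fun l => trF σ Fd l.1 j')
        (fun l => trG τ Gs l.1) (fun l => trG τ Gs l.1) (x : ℝ) (y ε x) x =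
      ∑ d ∈ rbox k x i, ∑ d' ∈ rbox k x i, ∑ e ∈ rbox k x i, ∑ e' ∈ rbox k x i,
        (if CoupledAdm (Pw x) m (couplingSet7 k x m p₀ i) (d, d') (e, e') then
          coupledLcmTermW phiInv (fun ℓ => trF σ Fd ℓ j) (fun ℓ => trF σ Fd ℓ j') (trG τ Gs)
            (trG τ Gs) (x : ℝ) (y ε x) (d, d') (e, e') else 0) := fun j j' =>
    (sum_rbox_coupledLcmTermW_eq phiInv (Pw x) m (couplingSet7 k x m p₀ i)
      (fun ℓ => trF σ Fd ℓ j) (fun ℓ => trF σ Fd ℓ j') (trG τ Gs) (trG τ Gs) (x : ℝ) (y ε x)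
      hx1 i).symm
  symm
  simp_rw [key]
  rw [sum_sum_mul_sum_comm]
  refine Finset.sum_congr rfl fun d _ => ?_
  rw [sum_sum_mul_sum_comm]
  refine Finset.sum_congr rfl fun d' _ => ?_
  rw [sum_sum_mul_sum_comm]
  refine Finset.sum_congr rfl fun e _ => ?_
  rw [sum_sum_mul_sum_comm]
  refine Finset.sum_congr rfl fun e' _ => ?_
  split_ifs
  · rfl
  · simp

end Maynard2016

end Literature.NumberTheory.Sieve

end
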